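import Summits.ResolutionOfSingularities.ResolutionOfSingularities.Theorems.EquisingularLiftEquisingularLiftNatCarrierDeltaComap
import Summits.ResolutionOfSingularities.ResolutionOfSingularities.Theorems.EquisingularLiftEquisingularLiftNatModelStep
import Summits.ResolutionOfSingularities.ResolutionOfSingularities.Theorems.EquisingularLiftEquisingularLiftSmoothNhdOfGoodAt
import Literature.AlgebraicGeometry.Resolution.AlterationsSectionDivisor
import Summits.ResolutionOfSingularities.ResolutionOfSingularities.Theorems.EquisingularLiftEquisingularLiftNatDeltaConeLift
import HarnessLib

/-!
# [OURS · L1 W4.5(b) · EL♮] (v), frame: the downstairs cone data of `comap_strictTransformIdeal_sup_comap_eq_of_model` READ OFF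
# THE MODEL SQUARE (quasi-regularity survives restriction to the special fibre; `Φ ≢ 0 mod 𝔪` descends)

Crux `EquisingularLiftNat` = stmt-ResolutionOfSingularities-20038 (child EL♮(3) = stmt-20148), route EquisingularLift, line `sections`;
helper file `--supports … --as helper` by res-D-pv-029 ((v) of res-L1-w45b-lead-2's HΔ(AdmTC) critical path). HONEST FRAMING: OURS;
NOT a statement of any manuscript. AI-written, weaker than expert review. No `sorry`; standard axioms.

`comap_strictTransformIdeal_sup_comap_eq_of_model` (…NatCarrierDeltaComap, p517803) takes, besides res-type-100's CONE PACK at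
`p = j x`, its IMAGE under `j^♯_x : 𝒪_{X',p} → 𝒪_{F₁,x}`: `hcbar` (the images of the quasi-regular `c` are quasi-regular) and
`hΦbar` (the reduction of `j^♯ Φ` modulo `(j^♯ c) = 𝔪_x` is non-zero). This file DISCHARGES both from the MODEL SQUARE
`IsPullback j t r' (Spec θ)` (`θ : O ↠ k`, `O` a DVR with uniformizer `ϖ`) and the two clauses of res-type-100's section frame
(`…NatCarrierDeltaSectionFrame`): `ϖ_p ∉ (c)` and `Φ ≢ 0 mod 𝔪_p`:

* `IsQuasiRegular.comp_of_surjective` — ALGEBRA (forms lift along surjections: res-type-032's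
  `exists_isHomogeneous_map_eq_of_surjective`, p516044); **quasi-regular sequences stay quasi-regular modulo `a`** when `(I : a) = I`, for a surjection `f` with `f a = 0`, `ker f ⊆ (a)`
  (Matsumura 16.2 (ii) `IsQuasiRegular.mem_pow_of_mul_mem_pow` + lifting of forms);
* `stalkMap_model_surjective`, `ker_stalkMap_model_le`, `stalkMap_model_varpi` — in a model square `j^♯_x` is onto, its kernel lies
  in `(ϖ_p)`, and `j^♯_x ϖ_p = 0` (`ker_fst_of_isClosedImmersion`, `stalkIdeal_ker_eq_ker_stalkMap`, `stalkMap_Γgerm_apply'`);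
* `isQuasiRegular_stalkMap_model`, `map_mk_map_stalkMap_ne_zero` — the two discharges;
* **`comap_strictTransformIdeal_sup_comap_eq_of_model'`** — (v) with res-type-100's hypotheses only (cone pack + `ϖ_p ∉ (c)` +
  `Φ ≢ 0 mod 𝔪_p`) and the model square.

References: H. Matsumura, *Commutative Ring Theory* (1986), Thm. 16.2; …NatCarrierDeltaComap (p517803); …NatCarrierDeltaStalks (p509910).
-/

set_option linter.dupNamespace false -- mandated namespace `Summit.<Summit>.<Problem>` of this single-conjunct summit
set_option linter.overlappingInstances false -- signatures carry `[IsDomain O] [IsDiscreteValuationRing O]`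

noncomputable section

open CategoryTheory CategoryTheory.Limits AlgebraicGeometry TopologicalSpace Topology IsLocalRing
open MvPolynomial Literature.AlgebraicGeometry.Resolution
open AlgebraicGeometry.Scheme.IdealSheafData
open Summit.ResolutionOfSingularities.ResolutionOfSingularities.Cruxes.EquisingularLift.StrataSplit

namespace Summit.ResolutionOfSingularities.ResolutionOfSingularities.Cruxes.EquisingularLiftNat.Sections

/-! ## Algebra: quasi-regularity modulo a relative non-zero-divisor -/

/-- **Quasi-regular sequences stay quasi-regular modulo a relative non-zero-divisor**: `x` quasi-regular in `R`, `I = (x)`,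
`a ∈ R` with `(I : a) = I`, and `f : R → S` surjective with `f a = 0` and `ker f ⊆ (a)` (so `S = R/(a)`); then `f ∘ x` is
quasi-regular in `S`. [cite: Matsumura1987, Thm. 16.2 (ii)] -/
theorem IsQuasiRegular.comp_of_surjective {R S : Type*} [CommRing R] [CommRing S] {r : ℕ} {x : Fin r → R}
    (hx : IsQuasiRegular x) {a : R}
    (ha : ∀ y, a * y ∈ Ideal.span (Set.range x) → y ∈ Ideal.span (Set.range x))
    (f : R →+* S) (hf : Function.Surjective f) (hfa : f a = 0) (hker : RingHom.ker f ≤ Ideal.span {a}) :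
    IsQuasiRegular (fun i => f (x i)) := by
  classical
  set I := Ideal.span (Set.range x) with hI
  have hIm : Ideal.span (Set.range fun i => f (x i)) = I.map f := by
    rw [hI, Ideal.map_span, ← Set.range_comp]; rfl
  intro n G hG hGev
  obtain ⟨F, hF, rfl⟩ := exists_isHomogeneous_map_eq_of_surjective f hf G hG
  -- `eval x F ∈ I^{n+1} + (a)`
  have hev : f (MvPolynomial.eval x F) = MvPolynomial.eval (fun i => f (x i)) (MvPolynomial.map f F) := by
    rw [MvPolynomial.eval_map, show MvPolynomial.eval x F = MvPolynomial.eval₂ (RingHom.id _) x F from rfl,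
      MvPolynomial.eval₂_comp_left, RingHom.comp_id]
    rfl
  have h1 : MvPolynomial.eval x F ∈ ((I ^ (n + 1)).map f).comap f := by
    rw [Ideal.mem_comap, hev, Ideal.map_pow, ← hIm]
    exact hGev
  rw [Ideal.comap_map_of_surjective _ hf] at h1
  obtain ⟨i, hi, k, hk, hik⟩ := Submodule.mem_sup.mp h1
  have hk' : k ∈ Ideal.span {a} := hker (by simpa using hk)
  obtain ⟨b, rfl⟩ := Ideal.mem_span_singleton'.mp hk'
  -- `a * b ∈ I^n`, hence `b ∈ I^n`, `b = eval x G₀` with `G₀` a form of degree `n`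
  have hFn : MvPolynomial.eval x F ∈ I ^ n := eval_mem_span_pow x hF
  have hab : a * b ∈ I ^ n := by
    have : b * a = MvPolynomial.eval x F - i := by rw [← hik]; ring
    rw [mul_comm, this]
    exact Ideal.sub_mem _ hFn (Ideal.pow_le_pow_right (Nat.le_succ n) hi)
  have hb : b ∈ I ^ n := hx.mem_pow_of_mul_mem_pow ha n hab
  obtain ⟨G₀, hG₀, hG₀b⟩ := exists_isHomogeneous_of_mem_span_pow x n hb
  -- `F - a • G₀` is a form of degree `n` with value `i ∈ I^{n+1}`: its coefficients lie in `I`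
  have hH : (F - MvPolynomial.C a * G₀).IsHomogeneous n := hF.sub (hG₀.C_mul a)
  have hHev : MvPolynomial.eval x (F - MvPolynomial.C a * G₀) ∈ I ^ (n + 1) := by
    rw [map_sub, map_mul, MvPolynomial.eval_C, hG₀b, show MvPolynomial.eval x F - a * b = i by rw [← hik]; ring]
    exact hi
  have hcoeff := (MvPolynomial.mem_map_C_iff.mp (hx n _ hH hHev))
  rw [MvPolynomial.mem_map_C_iff]
  intro m
  rw [MvPolynomial.coeff_map, hIm]
  have hm := hcoeff m
  rw [MvPolynomial.coeff_sub, MvPolynomial.coeff_C_mul] at hm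
  have : f (F.coeff m) = f (F.coeff m - a * G₀.coeff m) := by rw [map_sub, map_mul, hfa, zero_mul, sub_zero]
  rw [this]
  exact Ideal.mem_map_of_mem f hm

/-! ## The model square: `j^♯_x` is onto, kills `ϖ`, and has kernel inside `(ϖ)` -/

/-- In a model square, `j` is a closed immersion, so `j^♯_x` is surjective. [folklore] -/
theorem stalkMap_model_surjective {O k : Type} [CommRing O] [CommRing k] (θ : O →+* k) (hθ : Function.Surjective θ)
    {X' F₁ : Scheme.{0}} (r' : X' ⟶ Spec (.of O)) (j : F₁ ⟶ X') (t : F₁ ⟶ Spec (.of k))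
    (hsq : IsPullback j t r' (Spec.map (CommRingCat.ofHom θ))) (x : F₁) : Function.Surjective (j.stalkMap x).hom := by
  haveI : IsClosedImmersion (Spec.map (CommRingCat.ofHom θ)) := IsClosedImmersion.spec_of_surjective _ hθ
  haveI : IsClosedImmersion j := MorphismProperty.IsStableUnderBaseChange.of_isPullback hsq.flip inferInstance
  exact j.stalkMap_surjective x

/-- In a model square over a local ring, `j^♯_x` kills the germ of every element of `𝔪_O`. [folklore] -/
theorem stalkMap_model_varpi {O k : Type} [CommRing O] [IsLocalRing O] [Field k] (θ : O →+* k)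
    (hθ : Function.Surjective θ) {X' F₁ : Scheme.{0}} (r' : X' ⟶ Spec (.of O)) (j : F₁ ⟶ X') (t : F₁ ⟶ Spec (.of k))
    (hsq : IsPullback j t r' (Spec.map (CommRingCat.ofHom θ))) (x : F₁) (ϖ : O) (hϖ : ϖ ∈ maximalIdeal O) :
    (j.stalkMap x).hom ((X'.presheaf.Γgerm (j x)).hom (r'.appTop.hom ((Scheme.ΓSpecIso (.of O)).inv.hom ϖ))) = 0 := by
  have hθϖ : θ ϖ = 0 := by
    have hker : RingHom.ker θ = maximalIdeal O := IsLocalRing.eq_maximalIdeal (RingHom.ker_isMaximal_of_surjective θ hθ)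
    exact (RingHom.mem_ker).mp (hker ▸ hϖ)
  have h1 := congrArg (fun f => f.hom ϖ) (Scheme.ΓSpecIso_inv_naturality (CommRingCat.ofHom θ))
  simp only [CommRingCat.hom_comp, RingHom.comp_apply, CommRingCat.hom_ofHom] at h1
  have h2 := congrArg (fun f => f.appTop.hom ((Scheme.ΓSpecIso (.of O)).inv.hom ϖ)) hsq.w
  simp only [Scheme.Hom.comp_appTop, CommRingCat.hom_comp, RingHom.comp_apply] at h2
  rw [stalkMap_Γgerm_apply', h2, ← h1, hθϖ, map_zero, map_zero, map_zero]

/-- In a model square over a DVR with uniformizer `ϖ`, the kernel of `j^♯_x` lies in the ideal generated by the germ of `ϖ`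
(it IS that ideal; only `⊆` is recorded). [folklore] -/
theorem ker_stalkMap_model_le (O : Type) [CommRing O] [IsDomain O] [IsDiscreteValuationRing O] (k : Type) [Field k]
    (θ : O →+* k) (hθ : Function.Surjective θ) {X' F₁ : Scheme.{0}} (r' : X' ⟶ Spec (.of O))
    (j : F₁ ⟶ X') (t : F₁ ⟶ Spec (.of k)) (hsq : IsPullback j t r' (Spec.map (CommRingCat.ofHom θ))) (x : F₁)
    (ϖ : O) (hϖ : Irreducible ϖ) :
    RingHom.ker (j.stalkMap x).hom ≤
      Ideal.span {(X'.presheaf.Γgerm (j x)).hom (r'.appTop.hom ((Scheme.ΓSpecIso (.of O)).inv.hom ϖ))} := by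
  haveI : IsClosedImmersion (Spec.map (CommRingCat.ofHom θ)) := IsClosedImmersion.spec_of_surjective _ hθ
  haveI : IsClosedImmersion j := MorphismProperty.IsStableUnderBaseChange.of_isPullback hsq.flip inferInstance
  -- `ker j^♯_x = (ker j)_{j x}` and `ker j = 𝔪_O · 𝒪_{X'}`
  rw [← stalkIdeal_ker_eq_ker_stalkMap j x]
  have hj : j = hsq.isoPullback.hom ≫ pullback.fst r' (Spec.map (CommRingCat.ofHom θ)) := (hsq.isoPullback_hom_fst).symm
  have hker : j.ker = (Spec.map (CommRingCat.ofHom θ)).ker.comap r' := by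
    rw [hj, Scheme.Hom.ker_comp_of_isIso, Scheme.IdealSheafData.ker_fst_of_isClosedImmersion]
  rw [hker, stalkIdeal_comap_eq_map_stalkMap]
  -- `(ker Spec θ)_{s₀} ⊆ 𝔪_{s₀} = ϖ · 𝒪_{s₀}`
  have hrx : r' (j x) = closedPoint O := by
    have : j x ∈ Set.range j := ⟨x, rfl⟩
    rw [range_eq_preimage_of_isPullback hsq, range_specMap_of_surjective_of_field θ hθ] at this
    exact this
  set R := (Spec (.of O)).presheaf.stalk (r' (j x)) with hR
  letI : Algebra O R := StructureSheaf.stalkAlgebra O (r' (j x))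
  haveI : IsLocalization.AtPrime R (r' (j x)).asIdeal := StructureSheaf.IsLocalization.to_stalk O (r' (j x))
  have hle : stalkIdeal (Spec.map (CommRingCat.ofHom θ)).ker (r' (j x)) ≤ maximalIdeal R := by
    rw [← mem_support_iff_stalkIdeal_le]
    show r' (j x) ∈ ((Spec.map (CommRingCat.ofHom θ)).ker.support : Set _)
    rw [Scheme.Hom.support_ker, range_specMap_of_surjective_of_field θ hθ, hrx]
    exact subset_closure rfl
  refine (Ideal.map_mono hle).trans ?_
  have hpy : (r' (j x)).asIdeal = maximalIdeal O := by rw [hrx]; rfl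
  have hmR : maximalIdeal R = (maximalIdeal O).map (algebraMap O R) := by
    rw [← hpy]
    exact (IsLocalization.AtPrime.map_eq_maximalIdeal (r' (j x)).asIdeal R).symm
  rw [hmR, hϖ.maximalIdeal_eq, Ideal.map_span, Set.image_singleton, Ideal.map_span, Set.image_singleton,
    algebraMap_stalk_eq_Γgerm]
  exact le_of_eq (congrArg _ (congrArg _ (stalkMap_Γgerm_apply' r' (j x) _)))

/-! ## The two discharges and (v) with res-type-100's hypotheses -/

/-- **The images of the section frame are quasi-regular downstairs.** In a model square over a DVR with uniformizer `ϖ`: if `c` is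
quasi-regular in `𝒪_{X',j x}` with `𝒪/(c)` a domain and `ϖ_{j x} ∉ (c)` (res-type-100's section frame), then `j^♯_x ∘ c` is
quasi-regular in `𝒪_{F₁,x}`. [cite: Matsumura1987, Thm. 16.2 (ii)] -/
theorem isQuasiRegular_stalkMap_model (O : Type) [CommRing O] [IsDomain O] [IsDiscreteValuationRing O] (k : Type) [Field k]
    (θ : O →+* k) (hθ : Function.Surjective θ) {X' F₁ : Scheme.{0}} (r' : X' ⟶ Spec (.of O))
    (j : F₁ ⟶ X') (t : F₁ ⟶ Spec (.of k)) (hsq : IsPullback j t r' (Spec.map (CommRingCat.ofHom θ))) (x : F₁)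
    {r : ℕ} (c : Fin r → X'.presheaf.stalk (j x)) (hc : IsQuasiRegular c)
    [IsDomain (X'.presheaf.stalk (j x) ⧸ Ideal.span (Set.range c))] (ϖ : O) (hϖ : Irreducible ϖ)
    (hϖc : (X'.presheaf.Γgerm (j x)).hom (r'.appTop.hom ((Scheme.ΓSpecIso (.of O)).inv.hom ϖ)) ∉
      Ideal.span (Set.range c)) :
    IsQuasiRegular (fun i => (j.stalkMap x).hom (c i)) := by
  refine IsQuasiRegular.comp_of_surjective hc
    (a := (X'.presheaf.Γgerm (j x)).hom (r'.appTop.hom ((Scheme.ΓSpecIso (.of O)).inv.hom ϖ)))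
    (fun y hy => ?_) (j.stalkMap x).hom (stalkMap_model_surjective θ hθ r' j t hsq x)
    (stalkMap_model_varpi θ hθ r' j t hsq x ϖ (hϖ.maximalIdeal_eq ▸ Ideal.mem_span_singleton_self ϖ))
    (ker_stalkMap_model_le O k θ hθ r' j t hsq x ϖ hϖ)
  -- `(c) : ϖ = (c)` because `𝒪/(c)` is a domain not containing `ϖ̄ = 0`
  have h0 : Ideal.Quotient.mk (Ideal.span (Set.range c))
      ((X'.presheaf.Γgerm (j x)).hom (r'.appTop.hom ((Scheme.ΓSpecIso (.of O)).inv.hom ϖ))) ≠ 0 :=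
    fun h => hϖc (Ideal.Quotient.eq_zero_iff_mem.mp h)
  have hy' : Ideal.Quotient.mk (Ideal.span (Set.range c))
      ((X'.presheaf.Γgerm (j x)).hom (r'.appTop.hom ((Scheme.ΓSpecIso (.of O)).inv.hom ϖ))) *
      Ideal.Quotient.mk (Ideal.span (Set.range c)) y = 0 := by
    rw [← map_mul, Ideal.Quotient.eq_zero_iff_mem]; exact hy
  exact Ideal.Quotient.eq_zero_iff_mem.mp ((mul_eq_zero.mp hy').resolve_left h0)

/-- **`Φ ≢ 0 mod 𝔪_p` descends**: in a model square, if the images of `c` generate `𝔪_x` then the reduction of `j^♯ Φ` modulo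
`(j^♯ c)` is non-zero as soon as `Φ ≢ 0 mod 𝔪_{j x}`. [folklore] -/
theorem map_mk_map_stalkMap_ne_zero {X' F₁ : Scheme.{0}} (j : F₁ ⟶ X') (x : F₁) {r : ℕ}
    (c : Fin r → X'.presheaf.stalk (j x))
    (hc𝔪 : Ideal.span (Set.range fun i => (j.stalkMap x).hom (c i)) = maximalIdeal (F₁.presheaf.stalk x))
    (Φ : MvPolynomial (Fin r) (X'.presheaf.stalk (j x)))
    (hΦ𝔪 : MvPolynomial.map (residue (X'.presheaf.stalk (j x))) Φ ≠ 0) :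
    MvPolynomial.map (Ideal.Quotient.mk (Ideal.span (Set.range fun i => (j.stalkMap x).hom (c i))))
      (MvPolynomial.map (j.stalkMap x).hom Φ) ≠ 0 := by
  haveI hImax : (Ideal.span (Set.range fun i => (j.stalkMap x).hom (c i))).IsMaximal := by
    rw [hc𝔪]; exact maximalIdeal.isMaximal _
  letI : Field (F₁.presheaf.stalk x ⧸ Ideal.span (Set.range fun i => (j.stalkMap x).hom (c i))) :=
    Ideal.Quotient.field _
  haveI : (maximalIdeal (X'.presheaf.stalk (j x))).IsMaximal := maximalIdeal.isMaximal _
  letI : Field (X'.presheaf.stalk (j x) ⧸ maximalIdeal (X'.presheaf.stalk (j x))) := Ideal.Quotient.field _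
  -- `mk ∘ j^♯_x = ι ∘ residue` with `ι : κ(j x) → κ(x)` a ring map out of a field, hence injective
  have hle : maximalIdeal (X'.presheaf.stalk (j x)) ≤
      (Ideal.span (Set.range fun i => (j.stalkMap x).hom (c i))).comap (j.stalkMap x).hom := fun a ha => by
    rw [Ideal.mem_comap, hc𝔪]
    exact map_nonunit (j.stalkMap x).hom a ha
  have hfac : (Ideal.Quotient.mk (Ideal.span (Set.range fun i => (j.stalkMap x).hom (c i)))).comp (j.stalkMap x).hom =
      (Ideal.quotientMap _ (j.stalkMap x).hom hle).comp (residue (X'.presheaf.stalk (j x))) := by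
    ext a; rfl
  rw [MvPolynomial.map_map, hfac, ← MvPolynomial.map_map]
  intro h
  exact hΦ𝔪 (MvPolynomial.map_injective _ (RingHom.injective _) (h.trans (map_zero _).symm))

/-- **(v) with res-type-100's hypotheses only.** `comap_strictTransformIdeal_sup_comap_eq_of_model` (p517803) with its two
downstairs residual hypotheses discharged from the model square `IsPullback j t r' (Spec θ)` over a DVR `O ↠ k` and the section-frame
clauses `ϖ_{j x} ∉ (c)`, `Φ ≢ 0 mod 𝔪_{j x}`. [cite: StacksProject, Tag 0804; Matsumura1987, Thm. 16.2 (ii)] -/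
theorem comap_strictTransformIdeal_sup_comap_eq_of_model' (O : Type) [CommRing O] [IsDomain O] [IsDiscreteValuationRing O]
    (k : Type) [Field k] (θ : O →+* k) (hθ : Function.Surjective θ)
    {X' X₁ F₁ F₂ : Scheme.{0}} (r' : X' ⟶ Spec (.of O)) (τ : X₁ ⟶ X')
    (J K : X'.IdealSheafData) (hτ : IsBlowup τ J) [IsLocallyNoetherian X₁] [IsLocallyNoetherian F₂]
    [IsIntegral F₁] [IsIntegral F₂] [IsLocallyNoetherian F₁]
    (j : F₁ ⟶ X') (t : F₁ ⟶ Spec (.of k)) (hsq : IsPullback j t r' (Spec.map (CommRingCat.ofHom θ)))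
    (υ : F₂ ⟶ F₁) (j₂ : F₂ ⟶ X₁) (hcomm : j₂ ≫ τ = υ ≫ j)
    (x : F₁) (hx : IsClosed ({x} : Set F₁))
    (hυ : IsBlowup υ (vanishingIdeal ⟨{x}, hx⟩)) (hJ : J.comap j = vanishingIdeal ⟨{x}, hx⟩)
    {r : ℕ} (c : Fin r → X'.presheaf.stalk (j x)) (hcJ : Ideal.span (Set.range c) = stalkIdeal J (j x))
    (hc : IsQuasiRegular c) [IsDomain (X'.presheaf.stalk (j x) ⧸ Ideal.span (Set.range c))]
    {d : ℕ} (Φ : MvPolynomial (Fin r) (X'.presheaf.stalk (j x))) (hΦd : Φ.IsHomogeneous d)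
    (hK : stalkIdeal K (j x) = Ideal.span {MvPolynomial.eval c Φ})
    (ϖ : O) (hϖ : Irreducible ϖ)
    (hϖc : (X'.presheaf.Γgerm (j x)).hom (r'.appTop.hom ((Scheme.ΓSpecIso (.of O)).inv.hom ϖ)) ∉ Ideal.span (Set.range c))
    (hΦ𝔪 : MvPolynomial.map (residue (X'.presheaf.stalk (j x))) Φ ≠ 0) :
    (strictTransformIdeal τ J K ⊔ J.comap τ).comap j₂ =
      strictTransformIdeal υ (vanishingIdeal ⟨{x}, hx⟩) (K.comap j) ⊔ (vanishingIdeal ⟨{x}, hx⟩).comap υ := by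
  -- the images of `c` generate `𝔪_x`
  have hc𝔪 : Ideal.span (Set.range fun i => (j.stalkMap x).hom (c i)) = maximalIdeal (F₁.presheaf.stalk x) := by
    have hrange : Set.range (fun i => (j.stalkMap x).hom (c i)) = (j.stalkMap x).hom '' Set.range c := Set.range_comp _ _
    rw [hrange, ← Ideal.map_span, hcJ, ← stalkIdeal_comap_eq_map_stalkMap, hJ, stalkIdeal_vanishingIdeal_singleton hx]
  -- `Φ ≢ 0 mod (c)` follows from `Φ ≢ 0 mod 𝔪`
  have hΦ : MvPolynomial.map (Ideal.Quotient.mk (Ideal.span (Set.range c))) Φ ≠ 0 := by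
    intro h
    apply hΦ𝔪
    have hle : Ideal.span (Set.range c) ≤ maximalIdeal (X'.presheaf.stalk (j x)) := by
      rw [hcJ, ← mem_support_iff_stalkIdeal_le]
      have : x ∈ ((J.comap j).support : Set F₁) := by
        rw [hJ, Scheme.IdealSheafData.coe_support_vanishingIdeal]; rfl
      rw [Scheme.IdealSheafData.support_comap] at this
      exact this
    have hfac : residue (X'.presheaf.stalk (j x)) =
        (Ideal.Quotient.factor hle).comp (Ideal.Quotient.mk (Ideal.span (Set.range c))) := by
      ext a; rfl
    have h2 : MvPolynomial.map ((Ideal.Quotient.factor hle).comp (Ideal.Quotient.mk (Ideal.span (Set.range c)))) Φ =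
        MvPolynomial.map (Ideal.Quotient.factor hle) (MvPolynomial.map (Ideal.Quotient.mk (Ideal.span (Set.range c))) Φ) :=
      (MvPolynomial.map_map _ _ Φ).symm
    have h3 : MvPolynomial.map (Ideal.Quotient.factor hle)
        (MvPolynomial.map (Ideal.Quotient.mk (Ideal.span (Set.range c))) Φ) = 0 := by rw [h, map_zero]
    exact (congrArg (fun g => MvPolynomial.map g Φ) hfac).trans (h2.trans h3)
  exact comap_strictTransformIdeal_sup_comap_eq_of_model τ J K hτ j υ j₂ hcomm x hx hυ hJ c hcJ hc Φ hΦd hΦ hK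
    (isQuasiRegular_stalkMap_model O k θ hθ r' j t hsq x c hc ϖ hϖ hϖc)
    (map_mk_map_stalkMap_ne_zero j x c hc𝔪 Φ hΦ𝔪)

end Summit.ResolutionOfSingularities.ResolutionOfSingularities.Cruxes.EquisingularLiftNat.Sections

end
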